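import Mathlib
import Literature.Combinatorics.SimpleGraph.LovaszTheta
import HarnessLib

/-!
# `ϑ̄` is homomorphism-monotone: `G → H ⟹ ϑ(Ḡ) ≤ ϑ(H̄)`

"The `ϑ̄` quantity is monotone under graph homomorphisms in the sense that
`G → H ⟹ ϑ̄(G) ≤ ϑ̄(H)`" (Cubitt–Mančinska–Roberson–Severini–Stahlke–Winter 2014, §1, citing
de Carli Silva–Tunçel 2013), where `ϑ̄(G) = ϑ(Ḡ)`; in de Carli Silva–Tunçel (2013, §4) this is
the statement that the hypersphere number `t` (equivalently `ϑ̄`, by their Theorem relating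
`2t(G) + 1/ϑ̄(G) = 1`) satisfies "`t(G) ≤ t(H)` whenever `G → H`", and the observation
`K_{ω(G)} → G → K_{χ(G)}` then yields Lovász's Sandwich Theorem `ω(G) ≤ ϑ̄(G) ≤ χ(G)`
(their Theorem 3.7).

We prove the monotonicity directly in the maximisation form of the tree's `lovaszTheta`
(`Literature.Combinatorics.SimpleGraph.LovaszTheta`): if `f : G →g H` and `B` is feasible for
`ϑ(Gᶜ)` (`B ⪰ 0`, `Tr B = 1`, `B_{uv} = 0` for distinct non-adjacent `u, v` of `G`), then the
**push-forward** `f_* B = M_f B M_fᵀ`, `(f_* B)_{st} = Σ_{f u = s} Σ_{f v = t} B_{uv}`, is feasible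
for `ϑ(Hᶜ)` with the same objective: it is positive semidefinite as a congruence of `B`; its
trace is `Σ_{f u = f v} B_{uv} = Σ_u B_{uu} = 1` because two distinct vertices in one fibre of a
homomorphism are non-adjacent in `G`; and for distinct non-adjacent `s, t` of `H` every pair
`(u, v)` with `f u = s`, `f v = t` is a pair of distinct non-adjacent vertices of `G`.

## Contents

* `mapMatrix f`, `pushforward f B` (`= mapMatrix f * B * (mapMatrix f)ᴴ`), `pushforward_apply`,
  `trace_pushforward_eq` / `entrySum_pushforward`, `isThetaFeasible_compl_pushforward`;
* **`lovaszTheta_compl_le_of_hom (f : G →g H) : ϑ(Gᶜ) ≤ ϑ(Hᶜ)`**;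
* corollaries: `lovaszTheta_compl_le_of_le` (the tree's `lovaszTheta_compl_mono`, via
  `Hom.ofLE`), `card_le_lovaszTheta_compl_of_hom_top` (`K_U → G ⟹ |U| ≤ ϑ(Gᶜ)`, the clique
  half of the sandwich), `lovaszTheta_compl_le_card_of_hom_top` (`G → K_U ⟹ ϑ(Gᶜ) ≤ |U|`, the
  colouring half; a `c`-colouring is a homomorphism `G →g K_c`), and the sandwich
  `sandwich_of_homs : K_U → G → K_U' ⟹ |U| ≤ ϑ(Gᶜ) ≤ |U'|`.

## References

* M. K. de Carli Silva, L. Tunçel, *Optimization problems over unit-distance representations of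
  graphs*, Electron. J. Combin. 20(1) (2013) P43, §4 and Theorem 3.7 [SilvaTuncel2010] (held:
  arXiv:1010.6036, pp. 6 and 9 of the arXiv version).
* T. Cubitt, L. Mančinska, D. E. Roberson, S. Severini, D. Stahlke, A. Winter, *Bounds on
  entanglement-assisted source-channel coding via the Lovász `ϑ` number and its variants*, IEEE
  Trans. Inform. Theory 60 (2014) 7330–7344, §1 [CubittEtAl2013] (held: arXiv:1310.7120, p. 5).
-/

noncomputable section

namespace Literature.Combinatorics.SimpleGraph.LovaszThetaHom

open Matrix Finset
open Literature.Combinatorics.SimpleGraph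

variable {V W : Type*} [Fintype V] [Fintype W] [DecidableEq V] [DecidableEq W]

/-! ### The push-forward of a matrix along a vertex map -/

/-- The `0/1` matrix of a vertex map `f : V → W`: `(M_f)_{s u} = 1` iff `f u = s`. [folklore] -/
def mapMatrix (f : V → W) : Matrix W V ℝ := of fun s u => if f u = s then 1 else 0

/-- The push-forward `f_* B = M_f B M_fᴴ` of a `V × V` matrix along `f : V → W` (the feasible
matrix transported along a homomorphism). [cite: SilvaTuncel2010, §4 (v ∘ f: representations
transported along a homomorphism; arXiv p. 9)] -/
def pushforward (f : V → W) (B : Matrix V V ℝ) : Matrix W W ℝ :=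
  mapMatrix f * B * (mapMatrix f)ᴴ

omit [Fintype W] [DecidableEq V] in
/-- Entries of the push-forward: `(f_* B)_{st} = Σ_{f u = s} Σ_{f v = t} B_{uv}`. [folklore] -/
@[folklore] private theorem pushforward_apply (f : V → W) (B : Matrix V V ℝ) (s t : W) :
    pushforward f B s t =
      ∑ u ∈ univ.filter (fun u => f u = s), ∑ v ∈ univ.filter (fun v => f v = t), B u v := by
  have h1 : ∀ j, (mapMatrix f * B) s j = ∑ u ∈ univ.filter (fun u => f u = s), B u j := by
    intro j
    rw [mul_apply, sum_filter]
    refine sum_congr rfl fun u _ => ?_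
    simp only [mapMatrix, of_apply, boole_mul]
  rw [pushforward, mul_apply]
  simp_rw [h1, conjTranspose_apply, star_trivial, mapMatrix, of_apply, mul_boole]
  rw [sum_ite, sum_const_zero, add_zero]
  exact sum_comm

omit [DecidableEq V] in
/-- The push-forward of a positive semidefinite matrix is positive semidefinite (a congruence
`M B Mᴴ`). [folklore] -/
@[folklore] private theorem posSemidef_pushforward (f : V → W) {B : Matrix V V ℝ}
    (hB : B.PosSemidef) : (pushforward f B).PosSemidef :=
  hB.mul_mul_conjTranspose_same (mapMatrix f)

omit [DecidableEq V] in
/-- The push-forward preserves the objective: `Σ_{s,t} (f_* B)_{st} = Σ_{u,v} B_{uv}` (the fibres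
of `f` partition `V`). [folklore] -/
@[folklore] private theorem entrySum_pushforward (f : V → W) (B : Matrix V V ℝ) :
    entrySum (pushforward f B) = entrySum B := by
  have hfib : ∀ g : V → ℝ, ∑ s, ∑ u ∈ univ.filter (fun u => f u = s), g u = ∑ u, g u :=
    fun g => sum_fiberwise (univ : Finset V) f g
  calc entrySum (pushforward f B)
      = ∑ s, ∑ t, ∑ u ∈ univ.filter (fun u => f u = s),
          ∑ v ∈ univ.filter (fun v => f v = t), B u v := by
        simp only [entrySum, pushforward_apply]
    _ = ∑ s, ∑ u ∈ univ.filter (fun u => f u = s),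
          ∑ t, ∑ v ∈ univ.filter (fun v => f v = t), B u v := by
        refine sum_congr rfl fun s _ => ?_
        rw [sum_comm]
    _ = ∑ s, ∑ u ∈ univ.filter (fun u => f u = s), ∑ v, B u v := by
        refine sum_congr rfl fun s _ => sum_congr rfl fun u _ => hfib _
    _ = entrySum B := by rw [hfib]; rfl

/-! ### Feasibility along a homomorphism -/

section Hom

variable {G : SimpleGraph V} {H : SimpleGraph W}

omit [Fintype V] [Fintype W] [DecidableEq V] [DecidableEq W] in
/-- Distinct vertices whose images are equal or non-adjacent in `H` are non-adjacent in `G`,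
i.e. adjacent in `Gᶜ` (a homomorphism maps edges to edges). [folklore] -/
@[folklore] private theorem compl_adj_of_hom (f : G →g H) {u v : V} (huv : u ≠ v)
    (hst : ¬ H.Adj (f u) (f v)) : Gᶜ.Adj u v :=
  (SimpleGraph.compl_adj _ _ _).2 ⟨huv, fun hadj => hst (f.map_adj hadj)⟩

/-- Along a homomorphism the push-forward has the same trace: distinct vertices of one fibre are
non-adjacent in `G`, so their entries vanish and `Tr (f_* B) = Σ_u B_{uu}`. [folklore] -/
@[folklore] private theorem trace_pushforward_eq (f : G →g H) {B : Matrix V V ℝ}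
    (hB : IsThetaFeasible Gᶜ B) : (pushforward f B).trace = B.trace := by
  have hrow : ∀ s, ∀ u ∈ univ.filter (fun u => f u = s),
      ∑ v ∈ univ.filter (fun v => f v = s), B u v = B u u := by
    intro s u hu
    rw [← add_sum_erase _ (fun v => B u v) hu, sum_eq_zero fun v hv => ?_, add_zero]
    obtain ⟨hvu, hv'⟩ := mem_erase.1 hv
    have hfu : f u = s := (mem_filter.1 hu).2
    have hfv : f v = s := (mem_filter.1 hv').2
    refine hB.apply_eq_zero (compl_adj_of_hom f (fun h => hvu h.symm) ?_)
    rw [hfu, hfv]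
    exact H.irrefl
  simp only [Matrix.trace, Matrix.diag_apply, pushforward_apply]
  calc ∑ s, ∑ u ∈ univ.filter (fun u => f u = s), ∑ v ∈ univ.filter (fun v => f v = s), B u v
      = ∑ s, ∑ u ∈ univ.filter (fun u => f u = s), B u u :=
        sum_congr rfl fun s _ => sum_congr rfl (hrow s)
    _ = ∑ u, B u u := sum_fiberwise (univ : Finset V) f fun u => B u u

/-- **Feasibility is pushed forward along a homomorphism**: for `f : G →g H` and `B` feasible
for `ϑ(Gᶜ)`, `f_* B` is feasible for `ϑ(Hᶜ)`. [cite: SilvaTuncel2010, §4 (hypersphere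
representations transported along a homomorphism; arXiv p. 9)] -/
theorem isThetaFeasible_compl_pushforward (f : G →g H) {B : Matrix V V ℝ}
    (hB : IsThetaFeasible Gᶜ B) : IsThetaFeasible Hᶜ (pushforward f B) where
  posSemidef := posSemidef_pushforward f hB.posSemidef
  trace_eq_one := by rw [trace_pushforward_eq f hB, hB.trace_eq_one]
  apply_eq_zero s t hst := by
    obtain ⟨hst_ne, hst⟩ := (SimpleGraph.compl_adj _ _ _).1 hst
    rw [pushforward_apply]
    refine sum_eq_zero fun u hu => sum_eq_zero fun v hv => ?_
    have hfu : f u = s := (mem_filter.1 hu).2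
    have hfv : f v = t := (mem_filter.1 hv).2
    refine hB.apply_eq_zero (compl_adj_of_hom f (fun h => hst_ne ?_) ?_)
    · rw [← hfu, ← hfv, h]
    · rwa [hfu, hfv]

/-- **`ϑ̄` is homomorphism-monotone**: a homomorphism `G →g H` gives `ϑ(Gᶜ) ≤ ϑ(Hᶜ)`
("`G → H ⟹ ϑ̄(G) ≤ ϑ̄(H)`"). [cite: CubittEtAl2013, §1 (arXiv p. 5)] [cite: SilvaTuncel2010, §4
(t, equivalently ϑ̄, is hom-monotone; arXiv p. 9)] -/
theorem lovaszTheta_compl_le_of_hom (f : G →g H) : lovaszTheta Gᶜ ≤ lovaszTheta Hᶜ := by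
  refine Real.sSup_le ?_ (lovaszTheta_nonneg _)
  rintro _ ⟨B, hB, rfl⟩
  rw [← entrySum_pushforward f B]
  exact le_csSup (bddAbove_thetaValues Hᶜ) ⟨_, isThetaFeasible_compl_pushforward f hB, rfl⟩

end Hom

/-! ### Corollaries: subgraphs, cliques, colourings, the sandwich -/

/-- `G ≤ G'` is the homomorphism `Hom.ofLE`, so `ϑ(Gᶜ) ≤ ϑ(G'ᶜ)` — the tree's
`lovaszTheta_compl_mono`, recovered. [cite: SilvaTuncel2010, §4 ("if H is a subgraph of G, then
t(H) ≤ t(G)"; arXiv pp. 6, 9)] -/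
theorem lovaszTheta_compl_le_of_le {G G' : SimpleGraph V} (h : G ≤ G') :
    lovaszTheta Gᶜ ≤ lovaszTheta G'ᶜ :=
  lovaszTheta_compl_le_of_hom (SimpleGraph.Hom.ofLE h)

/-- `ϑ(K̄_U) = ϑ(⊥) ≥ |U|` (the `|U|`-clique `univ` of `K_U`; with `ϑ ≤ |V|` this is
`ϑ(K̄_n) = n`). [cite: SilvaTuncel2010, Theorem 3.7 and "ϑ̄(K_n) = n for every n ≥ 1"
(arXiv p. 6)] -/
theorem card_le_lovaszTheta_top_compl {U : Type*} [Fintype U] [DecidableEq U] :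
    (Fintype.card U : ℝ) ≤ lovaszTheta (⊤ : SimpleGraph U)ᶜ := by
  have hS : (⊤ : SimpleGraph U).IsNClique (Fintype.card U) univ :=
    ⟨fun u _ v _ huv => (SimpleGraph.top_adj u v).2 huv, card_univ⟩
  exact_mod_cast le_lovaszTheta_compl_of_isNClique hS

/-- **Clique half of the sandwich via homomorphisms**: `K_U → G ⟹ |U| ≤ ϑ(Gᶜ)`.
[cite: SilvaTuncel2010, §4 (K_{ω(G)} → G; arXiv p. 9) and Theorem 3.7] -/
theorem card_le_lovaszTheta_compl_of_hom_top {U : Type*} [Fintype U] [DecidableEq U]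
    {G : SimpleGraph V} (φ : (⊤ : SimpleGraph U) →g G) :
    (Fintype.card U : ℝ) ≤ lovaszTheta Gᶜ :=
  card_le_lovaszTheta_top_compl.trans (lovaszTheta_compl_le_of_hom φ)

/-- **Colouring half of the sandwich via homomorphisms**: `G → K_U ⟹ ϑ(Gᶜ) ≤ |U|` (a proper
colouring with colour set `U` is exactly a homomorphism `G →g K_U`; compare the tree's
`lovaszTheta_compl_le_of_coloring`). [cite: SilvaTuncel2010, §4 (G → K_{χ(G)}; arXiv p. 9) and
Theorem 3.7] -/
theorem lovaszTheta_compl_le_card_of_hom_top {U : Type*} [Fintype U] [DecidableEq U]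
    {G : SimpleGraph V} (φ : G →g (⊤ : SimpleGraph U)) :
    lovaszTheta Gᶜ ≤ Fintype.card U :=
  (lovaszTheta_compl_le_of_hom φ).trans (lovaszTheta_le_card _)

/-- **The Sandwich Theorem from hom-monotonicity**: `K_U → G → K_{U'} ⟹ |U| ≤ ϑ(Gᶜ) ≤ |U'|`
("`K_{ω(G)} → G → K_{χ(G)}` … yields `ω(G) ≤ ϑ̄(G) ≤ χ(G)`"). [cite: SilvaTuncel2010, §4 and
Theorem 3.7 (arXiv pp. 6, 9)] -/
theorem sandwich_of_homs {U U' : Type*} [Fintype U] [DecidableEq U] [Fintype U']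
    [DecidableEq U'] {G : SimpleGraph V} (φ : (⊤ : SimpleGraph U) →g G)
    (ψ : G →g (⊤ : SimpleGraph U')) :
    (Fintype.card U : ℝ) ≤ lovaszTheta Gᶜ ∧ lovaszTheta Gᶜ ≤ Fintype.card U' :=
  ⟨card_le_lovaszTheta_compl_of_hom_top φ, lovaszTheta_compl_le_card_of_hom_top ψ⟩

/-- In particular for a proper `c`-colouring `C : G.Coloring (Fin c)` (`= G →g K_c`):
`ϑ(Gᶜ) ≤ c`. [cite: SilvaTuncel2010, Theorem 3.7 (arXiv p. 6)] -/
theorem lovaszTheta_compl_le_of_coloring' {G : SimpleGraph V} {c : ℕ} (C : G.Coloring (Fin c)) :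
    lovaszTheta Gᶜ ≤ c := by
  have h := lovaszTheta_compl_le_card_of_hom_top C
  rwa [Fintype.card_fin] at h

end Literature.Combinatorics.SimpleGraph.LovaszThetaHom
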